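import Mathlib.RingTheory.PowerSeries.Trunc
import Mathlib.Algebra.Polynomial.BigOperators
import Mathlib.Analysis.SpecialFunctions.Exp
import Mathlib.Analysis.Complex.Exponential
import Mathlib.Data.Nat.Choose.Sum
import Mathlib.Data.Nat.Choose.Bounds
import Mathlib.Analysis.Normed.Field.Basic
import HarnessLib

/-!
# Turán's first main theorem on power sums (algebraic proof with explicit constants)

Topic `Literature/Analysis/Complex`, sub-namespace `PowerSum`. Everything in this file is PROVED.

**Turán's first main theorem** (P. Turán, *On a New Method of Analysis and its Applications*,
Wiley 1984, §6): if `z₁, …, zₙ ∈ ℂ` all satisfy `|z_j| ≥ ρ > 0` and `b₁, …, bₙ ∈ ℂ`, then for every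
integer `m ≥ 0` there is an exponent `ν` with `m + 1 ≤ ν ≤ m + n` such that

  `|b₁ z₁^ν + ⋯ + bₙ zₙ^ν| ≥ c(m, n) ρ^ν |b₁ + ⋯ + bₙ|`.

Turán's constant is `c(m, n) = (n / (2e(m + n)))ⁿ`. We prove the theorem with the explicit constant
`c(m, n) = 1 / (2ⁿ · C(m + n + 1, n + 1))` (`exists_powerSum_ge`), which has the same shape:
`C(m + n + 1, n + 1) ≤ (e (m + n + 1) / (n + 1))^{n+1}` (`choose_le_exp_mul_div_pow`), so
`c(m, n) ≥ ((n + 1) / (2e(m + n + 1)))^{n+1}` (`exists_powerSum_ge'`).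

## The proof (a coefficient identity; no analysis)

Normalise `ρ = 1` and put `u_j = z_j⁻¹`, so `|u_j| ≤ 1`. Let `P(X) = ∏_j (1 − u_j X)` (a polynomial of
degree `≤ n` whose coefficients have `ℓ¹`-norm `≤ 2ⁿ`) and let `H(X) = ∏_j (∑_a u_j^a X^a)` be the
power series inverse of `P` (`P · H = 1`); by induction on the number of factors and the hockey-stick
identity, `|[X^a] H| ≤ C(a + n, n)`. Let `H_{≤m}` be the truncation of `H` to degrees `≤ m` and
`F = P · H_{≤m}`, a polynomial of degree `≤ m + n`. For `ν ≤ m` the coefficient `[X^ν] F` equals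
`[X^ν](P H) = [ν = 0]`, so `F = 1 + ∑_{ν=m+1}^{m+n} c_ν X^ν`; and `F(z_j) = 0` for every `j`
because `P(z_j) = ∏_l (1 − z_j / z_l) = 0`. Hence `∑_{ν=m+1}^{m+n} (−c_ν) z_j^ν = 1` for all `j`,
so `∑_j b_j = ∑_ν (−c_ν) S_ν` with `S_ν = ∑_j b_j z_j^ν`, and
`|∑_j b_j| ≤ (∑_ν |c_ν|) max_ν |S_ν| ≤ 2ⁿ C(m + n + 1, n + 1) max_ν |S_ν|` since
`∑_ν |c_ν| ≤ (∑_k |[X^k]P|)(∑_{i ≤ m} |[X^i]H|) ≤ 2ⁿ ∑_{i ≤ m} C(i + n, n) = 2ⁿ C(m + n + 1, n + 1)`.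

This is the standard interpolation proof (Turán 1984, §6; Montgomery, *Ten lectures*, Ch. 5 §2)
written so that only coefficient bounds — no node separation — enter.

## Main results

* `PowerSum.exists_powerSum_ge` — the first main theorem with constant `2ⁿ C(m + n + 1, n + 1)`.
* `PowerSum.norm_sum_le_mul_sup_powerSum` — the same as a bound for `|∑ b_j|` by the maximum.
* `PowerSum.choose_le_exp_mul_div_pow` — `C(a, b) ≤ (e a / b)^b` (`b ≥ 1`).

## References

* P. Turán, *On a New Method of Analysis and its Applications*, Wiley 1984, §6 (first main theorem)
  [Turan1984NewMethod].
* P. Turán, *On Carlson's theorem in the theory of the zeta-function of Riemann*, Acta Math. Acad.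
  Sci. Hungar. 2 (1951) 39–73, Lemma II [Turan1951Carlson].
-/

noncomputable section

open Finset Polynomial

namespace Literature.Analysis.Complex.PowerSum

open _root_.Complex

/-! ### The geometric power series `∑ u^a X^a` inverts `1 − uX` -/

/-- The geometric series `G_u = ∑_a u^a X^a`. [folklore] -/
def geomSeries (u : ℂ) : PowerSeries ℂ := PowerSeries.mk fun a => u ^ a

/-- `(1 − uX) · ∑_a u^a X^a = 1` in `ℂ⟦X⟧`. [folklore] -/
theorem one_sub_mul_geomSeries (u : ℂ) :
    ((1 : PowerSeries ℂ) - PowerSeries.C u * PowerSeries.X) * geomSeries u = 1 := by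
  ext n
  rw [sub_mul, one_mul, map_sub, mul_assoc, PowerSeries.coeff_C_mul, PowerSeries.coeff_one]
  rcases n with _ | n
  · simp [geomSeries]
  · rw [PowerSeries.coeff_succ_X_mul]
    simp [geomSeries, pow_succ, mul_comm]

/-- `|[X^a] ∏_{j ∈ s} G_{u_j}| ≤ C(a + #s, #s)` when all `|u_j| ≤ 1` (induction on `s` and the
hockey-stick identity). [folklore] -/
theorem norm_coeff_prod_geomSeries_le {ι : Type*} [DecidableEq ι] (s : Finset ι) (u : ι → ℂ)
    (hu : ∀ j ∈ s, ‖u j‖ ≤ 1) (a : ℕ) :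
    ‖PowerSeries.coeff a (∏ j ∈ s, geomSeries (u j))‖ ≤ ((a + s.card).choose s.card : ℝ) := by
  induction s using Finset.induction_on generalizing a with
  | empty =>
    simp only [prod_empty, PowerSeries.coeff_one, card_empty, add_zero, Nat.choose_zero_right,
      Nat.cast_one]
    split_ifs <;> simp
  | @insert i s hi ih =>
    rw [prod_insert hi, mul_comm, PowerSeries.coeff_mul, card_insert_of_notMem hi]
    have hui : ‖u i‖ ≤ 1 := hu i (mem_insert_self i s)
    have hus : ∀ j ∈ s, ‖u j‖ ≤ 1 := fun j hj => hu j (mem_insert_of_mem hj)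
    calc ‖∑ p ∈ antidiagonal a, PowerSeries.coeff p.1 (∏ j ∈ s, geomSeries (u j)) *
            PowerSeries.coeff p.2 (geomSeries (u i))‖
        ≤ ∑ p ∈ antidiagonal a, ‖PowerSeries.coeff p.1 (∏ j ∈ s, geomSeries (u j)) *
            PowerSeries.coeff p.2 (geomSeries (u i))‖ := norm_sum_le _ _
      _ ≤ ∑ p ∈ antidiagonal a, ((p.1 + s.card).choose s.card : ℝ) := by
          refine sum_le_sum fun p _ => ?_
          rw [norm_mul]
          have h2 : ‖PowerSeries.coeff p.2 (geomSeries (u i))‖ ≤ 1 := by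
            simp only [geomSeries, PowerSeries.coeff_mk, norm_pow]
            exact pow_le_one₀ (norm_nonneg _) hui
          calc _ ≤ ((p.1 + s.card).choose s.card : ℝ) * 1 :=
                mul_le_mul (ih hus p.1) h2 (norm_nonneg _) (Nat.cast_nonneg _)
            _ = _ := mul_one _
      _ = ∑ k ∈ range (a + 1), ((k + s.card).choose s.card : ℝ) := by
          rw [Finset.Nat.sum_antidiagonal_eq_sum_range_succ_mk]
      _ = ((a + (s.card + 1)).choose (s.card + 1) : ℝ) := by
          rw [← add_assoc]
          exact_mod_cast Nat.sum_range_add_choose a s.card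

/-! ### The polynomial `P = ∏ (1 − u_j X)` and the `ℓ¹`-norm of coefficients -/

/-- `ℓ¹`-norm of the first `M` coefficients of a polynomial. [folklore] -/
def coeffNorm (M : ℕ) (f : ℂ[X]) : ℝ := ∑ k ∈ range M, ‖f.coeff k‖

/-- The coefficient norm is nonnegative. [folklore] -/
theorem coeffNorm_nonneg (M : ℕ) (f : ℂ[X]) : 0 ≤ coeffNorm M f :=
  sum_nonneg fun _ _ => norm_nonneg _

/-- Multiplying by `1 − uX` (`|u| ≤ 1`) at most doubles the `ℓ¹`-norm of the first `M`
coefficients. [folklore] -/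
theorem coeffNorm_one_sub_mul_le (M : ℕ) (f : ℂ[X]) {u : ℂ} (hu : ‖u‖ ≤ 1) :
    coeffNorm M ((1 - Polynomial.C u * Polynomial.X) * f) ≤ 2 * coeffNorm M f := by
  have hk : ∀ k, ‖((1 - Polynomial.C u * Polynomial.X) * f).coeff k‖ ≤
      ‖f.coeff k‖ + ‖(Polynomial.X * f).coeff k‖ := by
    intro k
    rw [sub_mul, one_mul, coeff_sub, mul_assoc, coeff_C_mul]
    refine (norm_sub_le _ _).trans ?_
    rw [norm_mul]
    have := mul_le_mul_of_nonneg_right hu (norm_nonneg ((Polynomial.X * f).coeff k))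
    linarith
  have hshift : ∑ k ∈ range M, ‖(Polynomial.X * f).coeff k‖ ≤ ∑ k ∈ range M, ‖f.coeff k‖ := by
    cases M with
    | zero => simp
    | succ M =>
      rw [Finset.sum_range_succ']
      simp only [Polynomial.coeff_X_mul, Polynomial.coeff_X_mul_zero, norm_zero, add_zero]
      rw [Finset.sum_range_succ]
      linarith [norm_nonneg (f.coeff M)]
  unfold coeffNorm
  calc ∑ k ∈ range M, ‖((1 - Polynomial.C u * Polynomial.X) * f).coeff k‖
      ≤ ∑ k ∈ range M, (‖f.coeff k‖ + ‖(Polynomial.X * f).coeff k‖) := sum_le_sum fun k _ => hk k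
    _ = ∑ k ∈ range M, ‖f.coeff k‖ + ∑ k ∈ range M, ‖(Polynomial.X * f).coeff k‖ := sum_add_distrib
    _ ≤ ∑ k ∈ range M, ‖f.coeff k‖ + ∑ k ∈ range M, ‖f.coeff k‖ := add_le_add le_rfl hshift
    _ = 2 * ∑ k ∈ range M, ‖f.coeff k‖ := by ring

/-- The polynomial `P = ∏_{j ∈ s} (1 − u_j X)`. [folklore] -/
def nodePoly {ι : Type*} (s : Finset ι) (u : ι → ℂ) : ℂ[X] :=
  ∏ j ∈ s, (1 - Polynomial.C (u j) * Polynomial.X)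

/-- `ℓ¹`-norm of the coefficients of `∏ (1 − u_j X)` is at most `2^{#s}` (`|u_j| ≤ 1`, `M ≥ 1`).
[folklore] -/
theorem coeffNorm_nodePoly_le {ι : Type*} [DecidableEq ι] (s : Finset ι) (u : ι → ℂ)
    (hu : ∀ j ∈ s, ‖u j‖ ≤ 1) (M : ℕ) (hM : 1 ≤ M) :
    coeffNorm M (nodePoly s u) ≤ (2 : ℝ) ^ s.card := by
  induction s using Finset.induction_on with
  | empty =>
    simp only [nodePoly, prod_empty, card_empty, pow_zero, coeffNorm]
    rcases M with _ | M
    · omega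
    · rw [sum_range_succ']
      simp [coeff_one]
  | @insert i s hi ih =>
    have hui : ‖u i‖ ≤ 1 := hu i (mem_insert_self i s)
    have hus : ∀ j ∈ s, ‖u j‖ ≤ 1 := fun j hj => hu j (mem_insert_of_mem hj)
    have hrec : nodePoly (insert i s) u = (1 - Polynomial.C (u i) * Polynomial.X) * nodePoly s u :=
      prod_insert hi
    rw [hrec, card_insert_of_notMem hi, pow_succ, mul_comm ((2 : ℝ) ^ _)]
    have h1 := coeffNorm_one_sub_mul_le M (nodePoly s u) hui
    have h2 := ih hus
    linarith

/-- The polynomial `P` vanishes at each node: `P(u_{j}⁻¹) = 0`, i.e. at `w_j` when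
`u_j = w_j⁻¹`, `w_j ≠ 0`. [folklore] -/
theorem eval_nodePoly_inv {ι : Type*} (s : Finset ι) (w : ι → ℂ) {j : ι} (hj : j ∈ s)
    (hw : w j ≠ 0) : (nodePoly s fun l => (w l)⁻¹).eval (w j) = 0 := by
  rw [nodePoly, eval_prod]
  exact prod_eq_zero hj (by simp [hw])

/-- `P` as a power series is `∏ (1 − u_j X)`. [folklore] -/
theorem coe_nodePoly {ι : Type*} (s : Finset ι) (u : ι → ℂ) :
    ((nodePoly s u : ℂ[X]) : PowerSeries ℂ) =
      ∏ j ∈ s, ((1 : PowerSeries ℂ) - PowerSeries.C (u j) * PowerSeries.X) := by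
  have h := map_prod (Polynomial.coeToPowerSeries.ringHom (R := ℂ))
    (fun j => (1 - Polynomial.C (u j) * Polynomial.X : ℂ[X])) s
  simp only [Polynomial.coeToPowerSeries.ringHom_apply] at h
  rw [nodePoly, h]
  refine prod_congr rfl fun j _ => ?_
  rw [Polynomial.coe_sub, Polynomial.coe_one, Polynomial.coe_mul, Polynomial.coe_C, Polynomial.coe_X]

/-- `P · H = 1`: the product of the geometric series inverts `P`. [folklore] -/
theorem coe_nodePoly_mul_prod_geomSeries {ι : Type*} (s : Finset ι) (u : ι → ℂ) :
    ((nodePoly s u : ℂ[X]) : PowerSeries ℂ) * ∏ j ∈ s, geomSeries (u j) = 1 := by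
  rw [coe_nodePoly, ← prod_mul_distrib]
  exact prod_eq_one fun j _ => one_sub_mul_geomSeries (u j)

/-! ### The interpolating polynomial `F = P · H_{≤ m}` -/

/-- `F = P · trunc_{m+1} H`. [folklore] -/
def interpPoly {ι : Type*} (s : Finset ι) (u : ι → ℂ) (m : ℕ) : ℂ[X] :=
  nodePoly s u * PowerSeries.trunc (m + 1) (∏ j ∈ s, geomSeries (u j))

/-- For `ν ≤ m`, `[X^ν] F = [X^ν] (P H) = [ν = 0]`. [folklore] -/
theorem coeff_interpPoly_of_le {ι : Type*} (s : Finset ι) (u : ι → ℂ) {m ν : ℕ} (hν : ν ≤ m) :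
    (interpPoly s u m).coeff ν = if ν = 0 then 1 else 0 := by
  have key : (interpPoly s u m).coeff ν =
      PowerSeries.coeff ν (((nodePoly s u : ℂ[X]) : PowerSeries ℂ) * ∏ j ∈ s, geomSeries (u j)) := by
    rw [interpPoly, coeff_mul, PowerSeries.coeff_mul]
    refine sum_congr rfl fun p hp => ?_
    rw [Polynomial.coeff_coe, PowerSeries.coeff_trunc]
    have : p.2 < m + 1 := by
      have := Finset.mem_antidiagonal.1 hp
      omega
    rw [if_pos this]
  rw [key, coe_nodePoly_mul_prod_geomSeries, PowerSeries.coeff_one]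

/-- `deg F ≤ m + #s`. [folklore] -/
theorem natDegree_interpPoly_le {ι : Type*} [DecidableEq ι] (s : Finset ι) (u : ι → ℂ) (m : ℕ) :
    (interpPoly s u m).natDegree ≤ m + s.card := by
  unfold interpPoly nodePoly
  refine (natDegree_mul_le).trans ?_
  have h1 : (∏ j ∈ s, (1 - Polynomial.C (u j) * Polynomial.X)).natDegree ≤ s.card := by
    refine (natDegree_prod_le _ _).trans ?_
    calc ∑ j ∈ s, (1 - Polynomial.C (u j) * Polynomial.X).natDegree ≤ ∑ _j ∈ s, 1 := by
          refine sum_le_sum fun j _ => ?_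
          refine (natDegree_sub_le _ _).trans (max_le (by simp) ?_)
          exact (natDegree_C_mul_le _ _).trans natDegree_X_le
      _ = s.card := by simp
  have h2 : (PowerSeries.trunc (m + 1) (∏ j ∈ s, geomSeries (u j))).natDegree ≤ m :=
    Nat.lt_succ_iff.mp (PowerSeries.natDegree_trunc_lt _ _)
  omega

/-- The interpolation identity: `∑_{ν = m+1}^{m+n} [X^ν]F · w_j^ν = −1` at every node `w_j ≠ 0`
(`u = w⁻¹`, `n = #s`). [cite: Turan1984NewMethod, §6] -/
theorem sum_coeff_interpPoly_mul_pow {ι : Type*} [DecidableEq ι] (s : Finset ι) (w : ι → ℂ)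
    (hw : ∀ j ∈ s, w j ≠ 0) (m : ℕ) {j : ι} (hj : j ∈ s) :
    ∑ ν ∈ Ico (m + 1) (m + s.card + 1),
      (interpPoly s (fun l => (w l)⁻¹) m).coeff ν * w j ^ ν = -1 := by
  set F := interpPoly s (fun l => (w l)⁻¹) m with hF
  -- `F(w_j) = 0`
  have heval : F.eval (w j) = 0 := by
    rw [hF, interpPoly, eval_mul, eval_nodePoly_inv s w hj (hw j hj), zero_mul]
  -- expand `F(w_j)` over `range (m + #s + 1)` and split at `m + 1`
  have hdeg : F.natDegree < m + s.card + 1 :=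
    Nat.lt_succ_of_le (natDegree_interpPoly_le s _ m)
  rw [eval_eq_sum_range' hdeg] at heval
  have hsplit := Finset.sum_range_add_sum_Ico (fun ν => F.coeff ν * w j ^ ν)
    (show m + 1 ≤ m + s.card + 1 by omega)
  have hlow : ∑ ν ∈ range (m + 1), F.coeff ν * w j ^ ν = 1 := by
    rw [sum_range_succ']
    have h0 : F.coeff 0 * w j ^ 0 = 1 := by
      rw [hF, coeff_interpPoly_of_le s _ (Nat.zero_le m)]; simp
    rw [h0]
    have hrest : ∑ ν ∈ range m, F.coeff (ν + 1) * w j ^ (ν + 1) = 0 := by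
      refine sum_eq_zero fun ν hν => ?_
      rw [hF, coeff_interpPoly_of_le s _ (by rw [mem_range] at hν; omega)]
      simp
    rw [hrest, zero_add]
  rw [hlow] at hsplit
  rw [← hsplit] at heval
  linear_combination heval

/-- `∑_{ν = m+1}^{m+n} |[X^ν] F| ≤ 2ⁿ C(m + n + 1, n + 1)` when all `|u_j| ≤ 1`.
[cite: Turan1984NewMethod, §6] -/
theorem sum_norm_coeff_interpPoly_le {ι : Type*} [DecidableEq ι] (s : Finset ι) (u : ι → ℂ)
    (hu : ∀ j ∈ s, ‖u j‖ ≤ 1) (m : ℕ) :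
    ∑ ν ∈ Ico (m + 1) (m + s.card + 1), ‖(interpPoly s u m).coeff ν‖ ≤
      (2 : ℝ) ^ s.card * ((m + s.card + 1).choose (s.card + 1) : ℝ) := by
  set M := m + s.card + 1 with hMdef
  set P := nodePoly s u with hP
  set Hm : ℂ[X] := PowerSeries.trunc (m + 1) (∏ j ∈ s, geomSeries (u j)) with hHm
  -- bound over the full range by the product of the `ℓ¹`-norms
  have hcoeff : ∀ ν, ‖(interpPoly s u m).coeff ν‖ ≤
      ∑ p ∈ antidiagonal ν, ‖P.coeff p.1‖ * ‖Hm.coeff p.2‖ := by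
    intro ν
    rw [interpPoly, ← hP, ← hHm, coeff_mul]
    refine (norm_sum_le _ _).trans (sum_le_sum fun p _ => ?_)
    rw [norm_mul]
  have hHm_coeff : ∀ i, ‖Hm.coeff i‖ ≤ if i < m + 1 then ((i + s.card).choose s.card : ℝ) else 0 := by
    intro i
    rw [hHm, PowerSeries.coeff_trunc]
    split_ifs with h
    · exact norm_coeff_prod_geomSeries_le s u hu i
    · simp
  -- Step 1: `∑_{ν ∈ Ico} ≤ ∑_{ν < M} ∑_{antidiag ν}`
  have h1 : ∑ ν ∈ Ico (m + 1) M, ‖(interpPoly s u m).coeff ν‖ ≤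
      ∑ ν ∈ range M, ∑ p ∈ antidiagonal ν, ‖P.coeff p.1‖ * ‖Hm.coeff p.2‖ := by
    calc _ ≤ ∑ ν ∈ range M, ‖(interpPoly s u m).coeff ν‖ := by
          refine sum_le_sum_of_subset_of_nonneg ?_ (fun _ _ _ => norm_nonneg _)
          intro ν hν
          rw [mem_Ico] at hν; rw [mem_range]; exact hν.2
      _ ≤ _ := sum_le_sum fun ν _ => hcoeff ν
  -- Step 2: the triangle `{(k,i) : k + i < M}` sits inside the square `range M × range M`
  have h2 : ∑ ν ∈ range M, ∑ p ∈ antidiagonal ν, ‖P.coeff p.1‖ * ‖Hm.coeff p.2‖ ≤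
      ∑ p ∈ range M ×ˢ range M, ‖P.coeff p.1‖ * ‖Hm.coeff p.2‖ := by
    rw [sum_sigma']
    set Sg := (range M).sigma fun ν => antidiagonal ν with hSg
    have hinj : ∀ x ∈ Sg, ∀ y ∈ Sg, (fun x : (Σ _ : ℕ, ℕ × ℕ) => x.2) x = (fun x => x.2) y → x = y := by
      rintro ⟨ν, p⟩ hx ⟨ν', p'⟩ hx' (h : p = p')
      simp only [hSg, mem_sigma, mem_antidiagonal] at hx hx'
      subst h
      have : ν = ν' := by omega
      subst this
      rfl
    rw [← Finset.sum_image (g := fun x : (Σ _ : ℕ, ℕ × ℕ) => x.2)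
      (f := fun p : ℕ × ℕ => ‖P.coeff p.1‖ * ‖Hm.coeff p.2‖) hinj]
    refine sum_le_sum_of_subset_of_nonneg ?_ (fun _ _ _ => mul_nonneg (norm_nonneg _) (norm_nonneg _))
    intro p hp
    rw [mem_image] at hp
    obtain ⟨⟨ν, p'⟩, hx, rfl⟩ := hp
    simp only [hSg, mem_sigma, mem_range, mem_antidiagonal] at hx
    simp only [mem_product, mem_range]
    omega
  -- Step 3: the square is the product of the two `ℓ¹`-norms
  have h3 : ∑ p ∈ range M ×ˢ range M, ‖P.coeff p.1‖ * ‖Hm.coeff p.2‖ =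
      coeffNorm M P * ∑ i ∈ range M, ‖Hm.coeff i‖ := by
    rw [sum_product, coeffNorm, sum_mul]
    refine sum_congr rfl fun k _ => ?_
    rw [mul_sum]
  -- Step 4: the two norms
  have hPnorm : coeffNorm M P ≤ (2 : ℝ) ^ s.card :=
    coeffNorm_nodePoly_le s u hu M (by omega)
  have hHnorm : ∑ i ∈ range M, ‖Hm.coeff i‖ ≤ ((m + s.card + 1).choose (s.card + 1) : ℝ) := by
    calc ∑ i ∈ range M, ‖Hm.coeff i‖
        ≤ ∑ i ∈ range M, (if i < m + 1 then ((i + s.card).choose s.card : ℝ) else 0) :=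
          sum_le_sum fun i _ => hHm_coeff i
      _ = ∑ i ∈ range (m + 1), ((i + s.card).choose s.card : ℝ) := by
          rw [← sum_filter]
          congr 1
          ext i
          simp only [mem_filter, mem_range, hMdef]
          omega
      _ = ((m + s.card + 1).choose (s.card + 1) : ℝ) := by
          exact_mod_cast Nat.sum_range_add_choose m s.card
  have hHnn : 0 ≤ ∑ i ∈ range M, ‖Hm.coeff i‖ := sum_nonneg fun _ _ => norm_nonneg _
  calc _ ≤ _ := h1
    _ ≤ _ := h2
    _ = _ := h3
    _ ≤ (2 : ℝ) ^ s.card * ((m + s.card + 1).choose (s.card + 1) : ℝ) :=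
        mul_le_mul hPnorm hHnorm hHnn (by positivity)

/-! ### The first main theorem -/

/-- **Turán's first main theorem, sum form** (nodes `|w_j| ≥ 1`): with `S_ν = ∑_j b_j w_j^ν`,
`|∑_j b_j| ≤ ∑_{ν=m+1}^{m+n} |c_ν| |S_ν|` for the coefficients `c_ν` of the interpolating
polynomial, whose total is `≤ 2ⁿ C(m + n + 1, n + 1)`. [cite: Turan1984NewMethod, §6] -/
theorem norm_sum_le_sum_mul_norm_powerSum {ι : Type*} [DecidableEq ι] (s : Finset ι)
    (w b : ι → ℂ) (hw : ∀ j ∈ s, 1 ≤ ‖w j‖) (m : ℕ) :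
    ‖∑ j ∈ s, b j‖ ≤ ∑ ν ∈ Ico (m + 1) (m + s.card + 1),
      ‖(interpPoly s (fun l => (w l)⁻¹) m).coeff ν‖ * ‖∑ j ∈ s, b j * w j ^ ν‖ := by
  have hw0 : ∀ j ∈ s, w j ≠ 0 := fun j hj h => by
    have := hw j hj; rw [h, norm_zero] at this; exact absurd this (by norm_num)
  set F := interpPoly s (fun l => (w l)⁻¹) m
  -- `∑ b_j = -∑_ν c_ν S_ν`
  have hid : ∑ j ∈ s, b j = -∑ ν ∈ Ico (m + 1) (m + s.card + 1),
      F.coeff ν * ∑ j ∈ s, b j * w j ^ ν := by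
    calc ∑ j ∈ s, b j = ∑ j ∈ s, b j * -∑ ν ∈ Ico (m + 1) (m + s.card + 1), F.coeff ν * w j ^ ν := by
          refine sum_congr rfl fun j hj => ?_
          rw [sum_coeff_interpPoly_mul_pow s w hw0 m hj]; ring
      _ = -∑ j ∈ s, ∑ ν ∈ Ico (m + 1) (m + s.card + 1), b j * (F.coeff ν * w j ^ ν) := by
          rw [← sum_neg_distrib]
          refine sum_congr rfl fun j _ => ?_
          rw [mul_neg, mul_sum]
      _ = -∑ ν ∈ Ico (m + 1) (m + s.card + 1), ∑ j ∈ s, b j * (F.coeff ν * w j ^ ν) := by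
          rw [sum_comm]
      _ = _ := by
          congr 1
          refine sum_congr rfl fun ν _ => ?_
          rw [mul_sum]
          refine sum_congr rfl fun j _ => ?_
          ring
  rw [hid, norm_neg]
  refine (norm_sum_le _ _).trans (sum_le_sum fun ν _ => ?_)
  rw [norm_mul]

/-- **Turán's first main theorem** (explicit constant). Let `s` be a nonempty finite index set,
`z_j ∈ ℂ` with `|z_j| ≥ ρ > 0` for `j ∈ s`, `b_j ∈ ℂ`, `n = #s`, `m ≥ 0`. Then there is
`ν ∈ [m + 1, m + n]` with
`ρ^ν |∑_j b_j| ≤ 2ⁿ C(m + n + 1, n + 1) · |∑_j b_j z_j^ν|`.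
[cite: Turan1984NewMethod, §6] -/
theorem exists_powerSum_ge {ι : Type*} (s : Finset ι) (hs : s.Nonempty) (z b : ι → ℂ) {ρ : ℝ}
    (hρ : 0 < ρ) (hz : ∀ j ∈ s, ρ ≤ ‖z j‖) (m : ℕ) :
    ∃ ν ∈ Icc (m + 1) (m + s.card),
      ρ ^ ν * ‖∑ j ∈ s, b j‖ ≤
        (2 : ℝ) ^ s.card * ((m + s.card + 1).choose (s.card + 1) : ℝ) * ‖∑ j ∈ s, b j * z j ^ ν‖ := by
  classical
  -- normalise: `w_j = z_j / ρ`
  set w : ι → ℂ := fun j => z j / ρ with hwdef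
  have hw : ∀ j ∈ s, 1 ≤ ‖w j‖ := by
    intro j hj
    rw [hwdef]; dsimp only
    rw [norm_div, Complex.norm_real, Real.norm_of_nonneg hρ.le, le_div_iff₀ hρ, one_mul]
    exact hz j hj
  have hmain := norm_sum_le_sum_mul_norm_powerSum s w b hw m
  -- the quantity `A_ν = ρ^{-ν} |S_ν(z)|` and its maximum over the window
  set A : ℕ → ℝ := fun ν => (ρ ^ ν)⁻¹ * ‖∑ j ∈ s, b j * z j ^ ν‖ with hA
  have hSw : ∀ ν, ‖∑ j ∈ s, b j * w j ^ ν‖ = A ν := by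
    intro ν
    rw [hA]; dsimp only
    have : ∑ j ∈ s, b j * w j ^ ν = ((ρ : ℂ) ^ ν)⁻¹ * ∑ j ∈ s, b j * z j ^ ν := by
      rw [mul_sum]
      refine sum_congr rfl fun j _ => ?_
      rw [hwdef]; dsimp only
      rw [div_pow, div_eq_mul_inv]
      ring
    rw [this, norm_mul, norm_inv, norm_pow, Complex.norm_real, Real.norm_of_nonneg hρ.le]
  have hne : (Icc (m + 1) (m + s.card)).Nonempty := by
    rw [nonempty_Icc]; have := hs.card_pos; omega
  obtain ⟨ν₀, hν₀, hmax⟩ := exists_max_image (Icc (m + 1) (m + s.card)) A hne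
  refine ⟨ν₀, hν₀, ?_⟩
  have hIco : Ico (m + 1) (m + s.card + 1) = Icc (m + 1) (m + s.card) := by
    ext ν; simp only [mem_Ico, mem_Icc]; omega
  have hbound : ‖∑ j ∈ s, b j‖ ≤
      (2 : ℝ) ^ s.card * ((m + s.card + 1).choose (s.card + 1) : ℝ) * A ν₀ := by
    calc ‖∑ j ∈ s, b j‖ ≤ ∑ ν ∈ Ico (m + 1) (m + s.card + 1),
          ‖(interpPoly s (fun l => (w l)⁻¹) m).coeff ν‖ * ‖∑ j ∈ s, b j * w j ^ ν‖ := hmain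
      _ ≤ ∑ ν ∈ Ico (m + 1) (m + s.card + 1),
          ‖(interpPoly s (fun l => (w l)⁻¹) m).coeff ν‖ * A ν₀ := by
          refine sum_le_sum fun ν hν => ?_
          rw [hSw]
          refine mul_le_mul_of_nonneg_left (hmax ν ?_) (norm_nonneg _)
          rwa [hIco] at hν
      _ = (∑ ν ∈ Ico (m + 1) (m + s.card + 1),
          ‖(interpPoly s (fun l => (w l)⁻¹) m).coeff ν‖) * A ν₀ := by rw [sum_mul]
      _ ≤ _ := by
          have hu : ∀ j ∈ s, ‖(w j)⁻¹‖ ≤ 1 := fun j hj => by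
            rw [norm_inv]; exact inv_le_one_of_one_le₀ (hw j hj)
          have hA0 : 0 ≤ A ν₀ := by rw [hA]; positivity
          exact mul_le_mul_of_nonneg_right (sum_norm_coeff_interpPoly_le s _ hu m) hA0
  -- multiply through by `ρ^ν₀`
  have hρν : 0 < ρ ^ ν₀ := pow_pos hρ _
  have hcancel : ρ ^ ν₀ * A ν₀ = ‖∑ j ∈ s, b j * z j ^ ν₀‖ := by
    rw [hA]; dsimp only
    rw [← mul_assoc, mul_inv_cancel₀ hρν.ne', one_mul]
  calc ρ ^ ν₀ * ‖∑ j ∈ s, b j‖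
      ≤ ρ ^ ν₀ * ((2 : ℝ) ^ s.card * ((m + s.card + 1).choose (s.card + 1) : ℝ) * A ν₀) :=
        mul_le_mul_of_nonneg_left hbound hρν.le
    _ = (2 : ℝ) ^ s.card * ((m + s.card + 1).choose (s.card + 1) : ℝ) * (ρ ^ ν₀ * A ν₀) := by ring
    _ = _ := by rw [hcancel]

/-- `C(a, b) ≤ (e a / b)^b` for `1 ≤ b`. (The same eight-line estimate is proved as
`Literature.Computability.MetaComplexity.choose_le_exp_mul_div_pow` in
`XorificationLiftProofs.lean`; it is re-proved here rather than importing that heavy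
proof-complexity module into complex analysis.) [folklore] -/
theorem choose_le_exp_mul_div_pow (a b : ℕ) (hb : 1 ≤ b) :
    (a.choose b : ℝ) ≤ (Real.exp 1 * a / b) ^ b := by
  have h1 : (a.choose b : ℝ) ≤ (a : ℝ) ^ b / (b.factorial : ℝ) := Nat.choose_le_pow_div b a
  have h2 : (b : ℝ) ^ b / (b.factorial : ℝ) ≤ Real.exp b :=
    Real.pow_div_factorial_le_exp (b : ℝ) (by positivity) b
  have hb0 : (0 : ℝ) < b := by exact_mod_cast hb
  have hfact : (0 : ℝ) < b.factorial := by exact_mod_cast Nat.factorial_pos b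
  -- `1 / b! ≤ (e / b)^b`
  have hexp : Real.exp 1 ^ b = Real.exp b := by
    rw [← Real.exp_nat_mul, mul_one]
  have h3 : 1 / (b.factorial : ℝ) ≤ (Real.exp 1 / b) ^ b := by
    rw [div_pow, hexp, div_le_div_iff₀ hfact (pow_pos hb0 _), one_mul]
    rw [div_le_iff₀ hfact] at h2
    linarith
  calc (a.choose b : ℝ) ≤ (a : ℝ) ^ b / b.factorial := h1
    _ = (a : ℝ) ^ b * (1 / b.factorial) := by ring
    _ ≤ (a : ℝ) ^ b * (Real.exp 1 / b) ^ b :=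
        mul_le_mul_of_nonneg_left h3 (by positivity)
    _ = (Real.exp 1 * a / b) ^ b := by rw [← mul_pow]; ring

/-- **Turán's first main theorem, classical shape of the constant**: there is
`ν ∈ [m + 1, m + n]` with
`ρ^ν |∑ b_j| ≤ (2 e (m + n + 1) / (n + 1))^{n+1} |∑ b_j z_j^ν|`
(compare Turán's `(2e(m + n)/n)ⁿ`). [cite: Turan1984NewMethod, §6] -/
theorem exists_powerSum_ge' {ι : Type*} (s : Finset ι) (hs : s.Nonempty) (z b : ι → ℂ) {ρ : ℝ}
    (hρ : 0 < ρ) (hz : ∀ j ∈ s, ρ ≤ ‖z j‖) (m : ℕ) :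
    ∃ ν ∈ Icc (m + 1) (m + s.card),
      ρ ^ ν * ‖∑ j ∈ s, b j‖ ≤
        (2 * Real.exp 1 * (m + s.card + 1 : ℕ) / (s.card + 1 : ℕ)) ^ (s.card + 1) *
          ‖∑ j ∈ s, b j * z j ^ ν‖ := by
  obtain ⟨ν, hν, h⟩ := exists_powerSum_ge s hs z b hρ hz m
  refine ⟨ν, hν, h.trans (mul_le_mul_of_nonneg_right ?_ (norm_nonneg _))⟩
  have hc := choose_le_exp_mul_div_pow (m + s.card + 1) (s.card + 1) (by omega)
  calc (2 : ℝ) ^ s.card * ((m + s.card + 1).choose (s.card + 1) : ℝ)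
      ≤ (2 : ℝ) ^ (s.card + 1) * (Real.exp 1 * (m + s.card + 1 : ℕ) / (s.card + 1 : ℕ)) ^ (s.card + 1) := by
        refine mul_le_mul (pow_le_pow_right₀ (by norm_num) (by omega)) hc (by positivity)
          (by positivity)
    _ = _ := by rw [← mul_pow]; ring

end Literature.Analysis.Complex.PowerSum
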